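import Summits.CriticalPhenomena.PercolationContinuityZ3.Theorems.Transplant.SkelNeg1ClosureO
import Summits.CriticalPhenomena.PercolationContinuityZ3.Theorems.Transplant.SkelNeg1Choice
import HarnessLib

/-!
# N1 (the {±1} node), WITH ORIENTATION: the residue-level target and the choices-as-data packaging over the ORIENTED Step-I″ output `O = (D, DT, ori)` —
# `Skelφ.FaceOblRM` (face residue with a window map PER FACE, hp-8 g33) + `kitAtRun_of_oblRHNM`, `PlanarSkeletonNeg.samePDropOfSkeletonNeg₁_of_residuesNO` (abstract scheme +
# three residues at each `q`), `StepI.OutO` / `OutO.FactsO`, `ChoiceNO` (choices as functions of `O`),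
# `AtQO`, the obligations `GeomHoldsNO / RootHoldsNO / FaceHoldsRNO / ReachHoldsRHNO` (+ `…Fn` forms over `ChoiceFnNO`) and **`samePDropOfSkeletonNeg₁_of_choiceFnNO`**

The κ-bound `|hgt| ≤ 10·n` of the chosen orientation is part of `FactsO`, so every residue may use it.  O-twins of `SkelNeg1ClosureResidues` / `SkelNeg1Choice` (same proofs).
builds on p205010 (kernel theorem, internal audit signed; external expert review pending) — nothing here uses p205010; `SamePDropOfSkeletonNeg₁` stays OPEN (conditional assembly).
Lane `prim-bschramm`, seat `prim-bschramm-p3` (gen 8; design owner); helper file (`--supports stmt-CriticalPhenomena-4575`); NEG-SCOPE B.8/B.9.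
[cite: KozmaNitzan2024, §4 Theorem 6 (pp. 25–31), Lemmas 10–12; §1 p. 2 (approach 1)] [cite: MartineauTassion2017, §3.4] [this work]
-/

noncomputable section

open MeasureTheory ProbabilityTheory
open scoped ENNReal Classical

namespace Summit.CriticalPhenomena.PercolationContinuityZ3.Theorems.Transplant

open Literature.Probability.Percolation Literature.Probability.LatticeModels SimpleGraph KNCells KNLevels
open Literature.Barriers.CriticalPhenomena (HasExponentialGrowth)

/-! ## §0 The face residue with a window map PER FACE (hp-8 g33's located request, adopted) -/

namespace Skelφ

open GadgetSystem ProbeHistory HSiteScheme Contour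
open Skel (winGraph winGraphIn RootOblT ReachOblRHN)

variable {V : Type} [DecidableEq V] [Countable V] (G : SimpleGraph V) [G.LocallyFinite] {A : Type*}

/-- **The face obligation at one face step with ITS OWN window map** (`u`-faces and `v`-faces read different exit frames): some `Lip` map `ψ'` with `FaceOblAt G ψ' …`.
[cite: KozmaNitzan2024, §4 p. 30 (Step III)] [this work] -/
def FaceOblAtM (S : KSchA V A) (FD : FaceData V A) (Δ' : ℕ) (δ₂ : ℝ) (h : ProbeHistory V) (e : Site 2 × MDir) (a a' : A) (du : MDir) (j : ℕ)
    (o : Finset (Sym2 V)) : Prop :=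
  ∃ ψ' : V → Site 2, Lip G ψ' ∧ FaceOblAt G ψ' S FD Δ' δ₂ h e a a' du j o

/-- **The face residue, run-restricted, map per face.** [cite: KozmaNitzan2024, §4 p. 30 (Step III)] [this work] -/
def FaceOblRM (S : KSchA V A) (FD : FaceData V A) (Δ' : ℕ) (δ₂ : ℝ) : Prop :=
  ∀ h e, S.IsRun₂ G h → (S.astOf₂ G h).st.choice = some e → S.Valid₂ G h e →
    ∀ du ∈ S.onward G h (tgt e), ∀ j < S.Γ.K, ∀ o : Finset (Sym2 V), FaceOblAtM G S FD Δ' δ₂ h e (S.aOf₁ G h e) (S.aOf₂ G h e) du j o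

variable {G}

omit [Countable V] in
/-- A one-map face residue is a per-face one. [folklore] -/
theorem faceOblRM_of_faceOblR {φ : V → Site 2} (hlip : Lip G φ) {S : KSchA V A} {FD : FaceData V A} {Δ' : ℕ} {δ₂ : ℝ} (h : FaceOblR G φ S FD Δ' δ₂) :
    FaceOblRM G S FD Δ' δ₂ :=
  fun hh e hrun hc hV du hdu j hj o => ⟨φ, hlip, h hh e hrun hc hV du hdu j hj o⟩

/-- **The run-restricted obligations from the residues with the PER-FACE face residue** (twin of `kitAtRun_of_oblRHN`; the `Lip` of the face's own map feeds `cond_of_faceOblAt`).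
[cite: KozmaNitzan2024, §4 (30), (32), Lemmas 10–12] -/
theorem kitAtRun_of_oblRHNM {S : KSchA V A} {FD : FaceData V A} {nmax Δ' : ℕ} {δ δ₂ ε'' : ℝ} {δr : ℕ → ℝ} (hδc : S.δc ≤ δ)
    (hstep : ∀ (c : V) (Rπ : ℕ) (Wg : Sym2 V → unitInterval) (s : KNLevels.TStep (winGraph G c Rπ)), s.KitsAt Wg S.p Δ' δ₂ →
      1 - δ₂ < (prodBernoulli Wg).real s.L.reachB → 1 - S.δc / 2 < (prodBernoulli Wg).real (⋃ t ∈ s.T, openConn s.L.o t))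
    (hchain : ∀ n ≤ nmax, ∀ (Ω : Finset V) (Wg : Sym2 V → unitInterval) (s : Fin (n + 1) → KNLevels.TStep (winGraphIn G Ω))
      (T' : Fin (n + 1) → Finset V) (η : ℝ),
      (∀ i : Fin (n + 1), (s i).L.o = (s 0).L.o) →
      (∀ i : Fin n, T' (Fin.castSucc i) ⊆ (s i.succ).L.X 0) →
      (∀ i : Fin (n + 1), T' i ⊆ (s i).T) →
      (∀ i : Fin (n + 1), (s i).KitsAt Wg S.p Δ' δ) →
      η ≤ δ / 2 →
      (∀ i : Fin (n + 1), (prodBernoulli Wg).real (⋃ t ∈ (s i).T \ T' i, openConn (s 0).L.o t) ≤ η) →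
      1 - δ < (prodBernoulli Wg).real (s 0).L.reachB →
        1 - ε'' < (prodBernoulli Wg).real (⋃ t ∈ T' (Fin.last n), openConn (s 0).L.o t))
    (hchainr : ∀ (n : ℕ) (c : V) (Rπ : ℕ) (Wg : Sym2 V → unitInterval) (s : Fin (n + 1) → KNLevels.TStep (winGraph G c Rπ))
      (T' : Fin (n + 1) → Finset V) (η : ℝ),
      (∀ i : Fin (n + 1), (s i).L.o = (s 0).L.o) →
      (∀ i : Fin n, T' (Fin.castSucc i) ⊆ (s i.succ).L.X 0) →
      (∀ i : Fin (n + 1), T' i ⊆ (s i).T) →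
      (∀ i : Fin (n + 1), (s i).KitsAt Wg S.p Δ' (δr n)) →
      η ≤ δr n / 2 →
      (∀ i : Fin (n + 1), (prodBernoulli Wg).real (⋃ t ∈ (s i).T \ T' i, openConn (s 0).L.o t) ≤ η) →
      1 - δr n < (prodBernoulli Wg).real (s 0).L.reachB →
        1 - S.δc < (prodBernoulli Wg).real (⋃ t ∈ T' (Fin.last n), openConn (s 0).L.o t))
    (hQ0 : RootOblT G S Δ' δr) (hface : FaceOblRM G S FD Δ' δ₂) (hreach : ReachOblRHN G nmax S FD Δ' δ) :
    KSchA.KitAtRun G S FD δ₂ ε'' := by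
  refine And.intro (Skel.rootObl_of_rootOblT hchainr hQ0) (And.intro ?_ ?_)
  · intro h e hrun hc hV du hdu j hj o hsrc
    obtain ⟨ψ', hlipψ', hF⟩ := hface h e hrun hc hV du hdu j hj o
    exact cond_of_faceOblAt hlipψ' hstep hF hsrc
  · intro h e hrun hc hV du hdu
    exact Skel.reach_of_reachOblAtHN hV hδc hchain (hreach h e hrun hc hV du hdu)

end Skelφ

/-! ## §1 The oriented Step-I″ output and its facts -/

namespace Skelφ.StepI

variable {V : Type} {G : SimpleGraph V} [G.LocallyFinite]

/-- **The oriented output of Step I″**: the two records and the orientation bit. [this work] -/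
structure OutO (V : Type) where
  /-- the record of the skeleton map `φ` -/
  D : DataN V
  /-- the record of the transposed map `trφ φ` -/
  DT : DataN V
  /-- the orientation chosen at `(t, M, n)` (`true` = `φ`) -/
  ori : V → ℕ → ℕ → Bool

/-- **The facts Step I″-O guarantees** (frames `hfr`, Φ2 `hC`, least seed level `m₀`, base vertex `t`): seed/radius/zone family of record, shared fields, and at every admissible
`(M, n)` the geometric clause AND the shear bound `|h| ≤ 10·n` of the chosen orientation. [this work] -/
def OutO.FactsO {φ : V → Site 2} {types : Finset V} [Countable V] (hfr : Frames G φ types) {p : unitInterval} (hC : CylSubcritical G φ types p) (m₀ : ℕ)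
    (t : V) (O : OutO V) : Prop :=
  m₀ ≤ O.D.k ∧ 1 ≤ O.D.k ∧ O.D.k ≤ O.D.M₀ ∧ O.D.R = fatRadius hfr hC ∧ O.D.Λ = fatSeq hfr hC ∧
    O.DT.Λ = O.D.Λ ∧ O.DT.k = O.D.k ∧ O.DT.R = O.D.R ∧ O.DT.M₀ = O.D.M₀ ∧ O.DT.n₁ = O.D.n₁ ∧
    ∀ M, O.D.M₀ ≤ M → ∀ n, O.D.n₁ M ≤ n →
      (O.ori t M n = true → O.D.EqGeom G φ t M n ∧ (O.D.hgt t M n).natAbs ≤ 10 * n) ∧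
      (O.ori t M n = false → O.DT.EqGeom G (trφ φ) t M n ∧ (O.DT.hgt t M n).natAbs ≤ 10 * n)

end Skelφ.StepI

namespace PlanarSkeletonNeg

open SkelConc (Consts)

/-! ## §2 The residue-level target with orientation -/

/-- **THE N1 PARTIAL CLOSURE FROM THE THREE RESIDUES, ORIENTED.**  As `samePDropOfSkeletonNeg₁_of_residuesN` with the oriented output `O` (facts `FactsO`) and the oriented family
`StepI.eventO`. [cite: KozmaNitzan2024, §4 Theorem 6 (pp. 25–31); §1 p. 2 (approach 1)] [this work] -/
theorem samePDropOfSkeletonNeg₁_of_residuesNO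
    (hres : ∀ (K₀ : ℕ) (δ δ₂ : ℝ) (δr : ℕ → ℝ), 0 < δ → δ ≤ 1 → 0 < δ₂ → δ₂ ≤ 1 → (∀ n, 0 < δr n ∧ δr n ≤ 1) →
      ∀ {V : Type} [DecidableEq V] [Countable V] (G : SimpleGraph V) [G.LocallyFinite] (Φ : PlanarSkeletonNeg G),
        ¬ HasExponentialGrowth G → ∀ t ∈ Φ.types, Φ.types = {t} → ∀ p : unitInterval, 0 < (p : ℝ) → (p : ℝ) < 1 →
          (∀ᵐ ω ∂bondPercolation G p, numInfiniteClusters ω ≤ 1) → ∀ hC : Φ.CylSubcritical p, 0 < theta G t p →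
            ∃ (δI : ℝ) (m₀ : ℕ), 0 < δI ∧ δI < 1 ∧
              ∀ O : Skelφ.StepI.OutO V, O.FactsO Φ.frame hC m₀ t →
                ∃ (Sz : Finset ℕ) (SMn : Finset (ℕ × ℕ)), (∀ M ∈ Sz, O.D.M₀ ≤ M) ∧ (∀ q ∈ SMn, O.D.M₀ ≤ q.1 ∧ O.D.n₁ q.1 ≤ q.2) ∧
                  ∀ q : unitInterval, (p : ℝ) / 2 ≤ q → (q : ℝ) ≤ p →
                    (∀ i ∈ Skelφ.StepI.indexNP {t} Sz SMn,
                      1 - δI < (bondPercolation G q).real (Skelφ.StepI.eventO G Φ.φ O.D O.DT O.ori i)) →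
                    Φ.CylSubcritical q →
                      ∃ (A : Type) (Γ : CellGeom V A) (FD : FaceData V A) (LD : LevelData V A),
                        Γ.root = t ∧ K₀ ≤ Γ.K ∧
                        RunGeom G Γ ∧ AnchGeom Γ ∧ SepGeom₂ G Γ ∧ ExitGeom G Γ ∧ StepsGeom Γ FD ∧ LevelGeom G Γ FD LD ∧
                        Skel.RootOblT G (⟨Γ, q, δ⟩ : KSchA V A) Φ.Δ δr ∧
                        Skelφ.FaceOblRM G (⟨Γ, q, δ⟩ : KSchA V A) FD Φ.Δ δ₂ ∧
                        Skel.ReachOblRHN G Skel.nmaxN (⟨Γ, q, δ⟩ : KSchA V A) FD Φ.Δ δ) :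
    SamePDropOfSkeletonNeg₁ := by
  refine samePDropOfSkeletonNeg₁_of_stepI_runO fun {V} _ _ G _ Φ hg t ht h1 p hp0 hp1 hU hC hθ => ?_
  have hε' : (0 : ℝ) < (1 / 2) ^ 35 := by positivity
  have hΔ : ∀ v, G.degree v ≤ Φ.Δ := Φ.degree_le
  obtain ⟨δ, hδ0, hδ1, hchainH⟩ : ∃ δ : ℝ, 0 < δ ∧ δ ≤ 1 ∧ ∀ n ≤ Skel.nmaxN, ∀ (q : unitInterval), (q : ℝ) < 1 →
      ∀ (G' : SimpleGraph V) [G'.LocallyFinite], G' ≤ G →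
        ∀ (Wt : Sym2 V → unitInterval) (s : Fin (n + 1) → TStep G') (T' : Fin (n + 1) → Finset V) (η : ℝ),
        (∀ i : Fin (n + 1), (s i).L.o = (s 0).L.o) →
        (∀ i : Fin n, T' (Fin.castSucc i) ⊆ (s i.succ).L.X 0) →
        (∀ i : Fin (n + 1), T' i ⊆ (s i).T) →
        (∀ i : Fin (n + 1), (s i).KitsAt Wt q Φ.Δ δ) →
        η ≤ δ / 2 →
        (∀ i : Fin (n + 1), (prodBernoulli Wt).real (⋃ t ∈ (s i).T \ T' i, openConn (s 0).L.o t) ≤ η) →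
        1 - δ < (prodBernoulli Wt).real (s 0).L.reachB →
          1 - (1 / 2 : ℝ) ^ 35 < (prodBernoulli Wt).real (⋃ t ∈ T' (Fin.last n), openConn (s 0).L.o t) :=
    ⟨Skelφ.δCN G hΔ Skel.nmaxN ((1 / 2) ^ 35), Skelφ.δCN_pos G hΔ _ _, Skelφ.δCN_le_one G hΔ _ _,
      fun n hn q hq1 G' _ hG' => Skelφ.δCN_spec G hΔ hε' hn hq1 G' hG'⟩
  obtain ⟨δ₂, hδ₂0, hδ₂1, hstep⟩ := SkelConc.apply_step_subgraph_UP G hΔ (half_pos hδ0)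
  have hrc := fun n : ℕ => SkelConc.chain_edge_subgraph_UP G hΔ n hδ0
  choose δr hδr0 hδr1 hchainr using hrc
  obtain ⟨K₀, hK₀⟩ := exists_pow_lt_of_lt_one hε' (show 1 - δ₂ < 1 by linarith)
  obtain ⟨δI, m₀, hδI, hδI1, hS⟩ := hres K₀ δ δ₂ δr hδ0 hδ1 hδ₂0 hδ₂1 (fun n => ⟨hδr0 n, hδr1 n⟩) G Φ hg t ht h1 p hp0 hp1 hU hC hθ
  refine ⟨δI, m₀, hδI, hδI1, fun D DT ori hk₀ hk₁ hkM hR hΛ e1 e2 e3 e4 e5 hgeom => ?_⟩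
  obtain ⟨Sz, SMn, hSz, hSMn, hB⟩ := hS ⟨D, DT, ori⟩ ⟨hk₀, hk₁, hkM, hR, hΛ, e1, e2, e3, e4, e5, hgeom⟩
  refine ⟨Sz, SMn, hSz, hSMn, fun q hq1 hq2 hcq hCq => ?_⟩
  have hq1' : (q : ℝ) < 1 := lt_of_le_of_lt hq2 hp1
  obtain ⟨A, Γ, FD, LD, hroot, hK, hrun, hanch, hsep, hexit, hsteps, hlev, hrootO, hfaceO, hreachO⟩ := hB q hq1 hq2 hcq hCq
  refine ⟨A, ⟨Γ, q, δ⟩, FD, LD, (1 / 2) ^ 35, δ₂, hroot, rfl, hrun, hanch, hsep, hexit, hsteps, hlev, hδ1, hε'.le, hδ₂1, ?_, ?_⟩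
  · have hKpow : (1 - δ₂) ^ Γ.K ≤ (1 / 2 : ℝ) ^ 35 := (pow_le_pow_of_le_one (by linarith) (by linarith) hK).trans hK₀.le
    have h32 : (4 : ℝ) * ((1 / 2) ^ 35 + (1 / 2) ^ 35) = (1 / 2) ^ 32 := by norm_num
    show 4 * ((1 - δ₂) ^ Γ.K + (1 / 2 : ℝ) ^ 35) ≤ (1 / 2) ^ 32
    linarith
  · exact Skelφ.kitAtRun_of_oblRHNM (S := ⟨Γ, q, δ⟩) le_rfl
      (fun c Rπ => hstep q hq1' (Skel.winGraph G c Rπ) (Skel.winGraph_le G c Rπ))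
      (fun n hn Ω => hchainH n hn q hq1' (Skel.winGraphIn G Ω) (Skel.winGraphIn_le G Ω))
      (fun n c Rπ => hchainr n q hq1' (Skel.winGraph G c Rπ) (Skel.winGraph_le G c Rπ)) hrootO hfaceO hreachO

/-! ## §3 Choices as data, oriented -/

variable {V : Type} [DecidableEq V] [Countable V] {G : SimpleGraph V} [G.LocallyFinite]

/-- **The N1 instance's choices, oriented**: as `ChoiceN`, with every choice a function of the oriented output `O`. [this work] -/
structure ChoiceNO (κ : Consts) (Φ : PlanarSkeletonNeg G) (t : V) (p : unitInterval) (hC : Φ.CylSubcritical p) where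
  /-- Step-I″ accuracy -/
  δI : ℝ
  /-- least seed level asked of Step I″ -/
  m₀ : ℕ
  /-- the finite list of zone sizes -/
  Sz : Skelφ.StepI.OutO V → Finset ℕ
  /-- the finite list of admissible (zone size, width) pairs -/
  SMn : Skelφ.StepI.OutO V → Finset (ℕ × ℕ)
  /-- the anchored cells at the running density -/
  Γ : Skelφ.StepI.OutO V → unitInterval → CellGeom V ℕ
  /-- the face data at the running density -/
  FD : Skelφ.StepI.OutO V → unitInterval → FaceData V ℕ
  /-- the level data at the running density -/
  LD : Skelφ.StepI.OutO V → unitInterval → LevelData V ℕ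
  δI_pos : 0 < δI
  δI_lt_one : δI < 1
  S_adm : ∀ O : Skelφ.StepI.OutO V, O.FactsO Φ.frame hC m₀ t →
    (∀ M ∈ Sz O, O.D.M₀ ≤ M) ∧ (∀ q ∈ SMn O, O.D.M₀ ≤ q.1 ∧ O.D.n₁ q.1 ≤ q.2)

namespace ChoiceNO

variable {κ : Consts} {Φ : PlanarSkeletonNeg G} {t : V} {p : unitInterval} {hC : Φ.CylSubcritical p}

/-- **The premises of step (B) at `q`, oriented.** [this work] -/
def AtQO (𝒞 : ChoiceNO κ Φ t p hC) (O : Skelφ.StepI.OutO V) (q : unitInterval) : Prop :=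
  O.FactsO Φ.frame hC 𝒞.m₀ t ∧ (p : ℝ) / 2 ≤ q ∧ (q : ℝ) ≤ p ∧
    (∀ i ∈ Skelφ.StepI.indexNP {t} (𝒞.Sz O) (𝒞.SMn O), 1 - 𝒞.δI < (bondPercolation G q).real (Skelφ.StepI.eventO G Φ.φ O.D O.DT O.ori i)) ∧
    Φ.CylSubcritical q

/-- The chosen scheme at `q`. [this work] -/
abbrev scheme (𝒞 : ChoiceNO κ Φ t p hC) (O : Skelφ.StepI.OutO V) (q : unitInterval) : KSchA V ℕ := ⟨𝒞.Γ O q, q, κ.δ⟩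

/-- **The geometric obligation, oriented.** [this work] -/
def GeomHoldsNO (𝒞 : ChoiceNO κ Φ t p hC) : Prop :=
  ∀ (O : Skelφ.StepI.OutO V) (q : unitInterval), 𝒞.AtQO O q →
    (𝒞.Γ O q).root = t ∧ κ.K₀ ≤ (𝒞.Γ O q).K ∧
      RunGeom G (𝒞.Γ O q) ∧ AnchGeom (𝒞.Γ O q) ∧ SepGeom₂ G (𝒞.Γ O q) ∧ ExitGeom G (𝒞.Γ O q) ∧ StepsGeom (𝒞.Γ O q) (𝒞.FD O q) ∧
      LevelGeom G (𝒞.Γ O q) (𝒞.FD O q) (𝒞.LD O q)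

/-- **The root residue, oriented** ((R)/kits at the root). [this work] -/
def RootHoldsNO (𝒞 : ChoiceNO κ Φ t p hC) : Prop :=
  ∀ (O : Skelφ.StepI.OutO V) (q : unitInterval), 𝒞.AtQO O q → Skel.RootOblT G (𝒞.scheme O q) Φ.Δ κ.δr

/-- **The face residue, oriented, window map per face** ((F); hp-8 g33's form). [this work] -/
def FaceHoldsRNO (𝒞 : ChoiceNO κ Φ t p hC) : Prop :=
  ∀ (O : Skelφ.StepI.OutO V) (q : unitInterval), 𝒞.AtQO O q → Skelφ.FaceOblRM G (𝒞.scheme O q) (𝒞.FD O q) Φ.Δ κ.δ₂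

/-- **The corridor residue, oriented, budget `nmaxN`** ((C)). [this work] -/
def ReachHoldsRHNO (𝒞 : ChoiceNO κ Φ t p hC) : Prop :=
  ∀ (O : Skelφ.StepI.OutO V) (q : unitInterval), 𝒞.AtQO O q → Skel.ReachOblRHN G Skel.nmaxN (𝒞.scheme O q) (𝒞.FD O q) Φ.Δ κ.δ

end ChoiceNO

/-- **An oriented N1 choice function.** [this work] -/
def ChoiceFnNO : Type 1 :=
  ∀ (κ : Consts) {V : Type} [DecidableEq V] [Countable V] (G : SimpleGraph V) [G.LocallyFinite] (Φ : PlanarSkeletonNeg G),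
    ¬ HasExponentialGrowth G → ∀ (t : V), t ∈ Φ.types → Φ.types = {t} → ∀ (p : unitInterval), 0 < (p : ℝ) → (p : ℝ) < 1 →
      ∀ (hC : Φ.CylSubcritical p), ChoiceNO κ Φ t p hC

/-- The geometric obligation of an oriented choice function. [this work] -/
def GeomHoldsNOFn (𝒞₀ : ChoiceFnNO) : Prop :=
  ∀ (κ : Consts) {V : Type} [DecidableEq V] [Countable V] (G : SimpleGraph V) [G.LocallyFinite] (Φ : PlanarSkeletonNeg G)
    (hg : ¬ HasExponentialGrowth G) (t : V) (ht : t ∈ Φ.types) (h1 : Φ.types = {t}) (p : unitInterval) (hp0 : 0 < (p : ℝ)) (hp1 : (p : ℝ) < 1)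
    (hC : Φ.CylSubcritical p), (𝒞₀ κ G Φ hg t ht h1 p hp0 hp1 hC).GeomHoldsNO

/-- The root obligation of an oriented choice function. [this work] -/
def RootHoldsNOFn (𝒞₀ : ChoiceFnNO) : Prop :=
  ∀ (κ : Consts) {V : Type} [DecidableEq V] [Countable V] (G : SimpleGraph V) [G.LocallyFinite] (Φ : PlanarSkeletonNeg G)
    (hg : ¬ HasExponentialGrowth G) (t : V) (ht : t ∈ Φ.types) (h1 : Φ.types = {t}) (p : unitInterval) (hp0 : 0 < (p : ℝ)) (hp1 : (p : ℝ) < 1)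
    (hC : Φ.CylSubcritical p), (𝒞₀ κ G Φ hg t ht h1 p hp0 hp1 hC).RootHoldsNO

/-- The face obligation of an oriented choice function. [this work] -/
def FaceHoldsRNOFn (𝒞₀ : ChoiceFnNO) : Prop :=
  ∀ (κ : Consts) {V : Type} [DecidableEq V] [Countable V] (G : SimpleGraph V) [G.LocallyFinite] (Φ : PlanarSkeletonNeg G)
    (hg : ¬ HasExponentialGrowth G) (t : V) (ht : t ∈ Φ.types) (h1 : Φ.types = {t}) (p : unitInterval) (hp0 : 0 < (p : ℝ)) (hp1 : (p : ℝ) < 1)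
    (hC : Φ.CylSubcritical p), (𝒞₀ κ G Φ hg t ht h1 p hp0 hp1 hC).FaceHoldsRNO

/-- The corridor obligation of an oriented choice function. [this work] -/
def ReachHoldsRHNOFn (𝒞₀ : ChoiceFnNO) : Prop :=
  ∀ (κ : Consts) {V : Type} [DecidableEq V] [Countable V] (G : SimpleGraph V) [G.LocallyFinite] (Φ : PlanarSkeletonNeg G)
    (hg : ¬ HasExponentialGrowth G) (t : V) (ht : t ∈ Φ.types) (h1 : Φ.types = {t}) (p : unitInterval) (hp0 : 0 < (p : ℝ)) (hp1 : (p : ℝ) < 1)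
    (hC : Φ.CylSubcritical p), (𝒞₀ κ G Φ hg t ht h1 p hp0 hp1 hC).ReachHoldsRHNO

/-! ## §4 The single-type node from an oriented choice function -/

/-- **THE N1 PARTIAL CLOSURE OF RECORD, oriented shared-choice form**: an oriented choice function meeting the four obligations gives `SamePDropOfSkeletonNeg₁`.
[cite: KozmaNitzan2024, §4 Theorem 6 (pp. 25–31); §1 p. 2] [this work] -/
theorem samePDropOfSkeletonNeg₁_of_choiceFnNO (𝒞₀ : ChoiceFnNO) (hGm : GeomHoldsNOFn 𝒞₀) (hR : RootHoldsNOFn 𝒞₀) (hF : FaceHoldsRNOFn 𝒞₀)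
    (hRe : ReachHoldsRHNOFn 𝒞₀) : SamePDropOfSkeletonNeg₁ := by
  refine samePDropOfSkeletonNeg₁_of_residuesNO
    fun K₀ δ δ₂ δr hδ0 hδ1 hδ₂0 hδ₂1 hδr {V} _ _ G _ Φ hg t ht h1 p hp0 hp1 _ hC _ => ?_
  set κ : Consts := ⟨K₀, δ, δ₂, δr, hδ0, hδ1, hδ₂0, hδ₂1, hδr⟩ with hκ
  set 𝒞 := 𝒞₀ κ G Φ hg t ht h1 p hp0 hp1 hC with h𝒞
  refine ⟨𝒞.δI, 𝒞.m₀, 𝒞.δI_pos, 𝒞.δI_lt_one, fun O hfacts => ?_⟩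
  obtain ⟨hSz, hSMn⟩ := 𝒞.S_adm O hfacts
  refine ⟨𝒞.Sz O, 𝒞.SMn O, hSz, hSMn, fun q hq1 hq2 hin hCq => ?_⟩
  have hat : 𝒞.AtQO O q := ⟨hfacts, hq1, hq2, hin, hCq⟩
  obtain ⟨hroot, hK, hrun, hanch, hsep, hexit, hsteps, hlev⟩ := hGm κ G Φ hg t ht h1 p hp0 hp1 hC O q hat
  exact ⟨ℕ, 𝒞.Γ O q, 𝒞.FD O q, 𝒞.LD O q, hroot, hK, hrun, hanch, hsep, hexit, hsteps, hlev,
    hR κ G Φ hg t ht h1 p hp0 hp1 hC O q hat, hF κ G Φ hg t ht h1 p hp0 hp1 hC O q hat, hRe κ G Φ hg t ht h1 p hp0 hp1 hC O q hat⟩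

end PlanarSkeletonNeg

end Summit.CriticalPhenomena.PercolationContinuityZ3.Theorems.Transplant

end
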